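import Summits.ValiantsHypothesis.ValiantsHypothesis.Theorems.BarrierLeverPartitionMinorsMooreBench
import Summits.ValiantsHypothesis.ValiantsHypothesis.Theorems.BarrierLeverPartitionMinorsMooreBenchToolkit
import Summits.ValiantsHypothesis.ValiantsHypothesis.Theorems.BarrierLeverChowCubeThetaHatPeel

/-!
# Route BarrierLever — item 20172 (CPM), benchmark row 14: the Moore–Chow benchmark columns and
# the rows of `Θ̂` of size `≤ 2` as stage-1 rows of the peel

Helper file (`--supports stmt-ValiantsHypothesis-20172`; cell valiant-natproofs, rung V4, 𝒟-side of
door (c), benchmark «row 14»; seat valiant-natproofs-prover gen 14).  Closes NO item; definition-free.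
Objects from `…MooreBench` (`benchCols`, `mooreChowFactor`, `MCBenchPairsAt`, `rowVec`, `stageRows`,
`nodeY`, `bits`, `bin`, `windowStart`).

* The benchmark columns `benchCols h r j`, `j < r ≤ 2^h`, are injective and down-closed
  (`benchCols_injective`, `benchCols_downClosed`), so the Γ-reduction of val-np-p2
  (`ChowCube.det_xPrivate_eq_det_thetaHat`) applies to the x-private Moore–Chow design with the
  SYMBOLIC node table `q a c = (X a)^(2^c)` over `A = MvPolynomial (Fin h) ℂ`:
  `det[coeff_{E (u i) (benchCols j)} ∏_a (x_a + A_a)] = det Θ̂[u, benchCols]`.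
* `thetaHat_row_eq_rowVec` — for `|U| ≤ 2`, row `U` of `Θ̂` is `(-1)^{|T|}` times the stage-1 peel row
  `rowVec r (nodeY h) (label U)` (`label ∅ = e_0`, `label {b} = (T_0,{b})`, `label {b<b'} = (∅,{b,b'})`).
* The reduction `MCBenchPairsAt h ⟸` «the stage-1 family is linearly independent» is in the
  companion file `…MooreBenchReduction`.

WHAT THIS IS NOT: the peel itself (file `…MooreBenchPeel`); nothing on items 20172 / 20195 / 19717,
crux stmt-ValiantsHypothesis-14610, or `VP` versus `VNP`.
-/

set_option linter.dupNamespace false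

namespace Summit.ValiantsHypothesis.ValiantsHypothesis.Theorems.BarrierLever.MoorePeel

open MvPolynomial Finset
open Summit.ValiantsHypothesis.ValiantsHypothesis.Theorems.BarrierLever.ChowCube
  (thetaHat_empty_row thetaHat_singleton_row thetaHat_insert)

/-! ## 1. The benchmark columns -/

/-- `|benchCols h r j| = |bits j|` for `j < 2^h`. -/
theorem card_benchCols {h r : ℕ} (j : Fin r) (hj : (j : ℕ) < 2 ^ h) :
    (benchCols h r j).card = (bits (j : ℕ)).card := by
  rw [← map_benchCols j hj, Finset.card_map]

/-- `Σ_{c ∈ benchCols h r j} 2^c = j` for `j < 2^h`. -/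
theorem sum_two_pow_benchCols {h r : ℕ} (j : Fin r) (hj : (j : ℕ) < 2 ^ h) :
    ∑ c ∈ benchCols h r j, 2 ^ (c : ℕ) = (j : ℕ) := by
  have e : ∑ c ∈ benchCols h r j, 2 ^ (c : ℕ) = bin ((benchCols h r j).map Fin.valEmbedding) := by
    rw [bin, Finset.sum_map]
    rfl
  rw [e, map_benchCols j hj, bin_bits]

/-- A subset of `Fin h`, read as a set of naturals, has code `< 2^h`. -/
theorem bin_map_lt_two_pow {h : ℕ} (S : Finset (Fin h)) : bin (S.map Fin.valEmbedding) < 2 ^ h := by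
  rw [bin, Finset.sum_map]
  calc ∑ c ∈ S, 2 ^ (Fin.valEmbedding c : ℕ) ≤ ∑ c : Fin h, 2 ^ (c : ℕ) :=
        Finset.sum_le_sum_of_subset_of_nonneg (Finset.subset_univ S) fun _ _ _ => Nat.zero_le _
    _ < 2 ^ h := by
        rw [Fin.sum_univ_eq_sum_range (fun c => 2 ^ c) h]
        have := Nat.geomSum_lt (le_refl 2) (s := Finset.range h) (n := h)
          (fun k hk => Finset.mem_range.mp hk)
        simpa using this

/-- The set with code `bin S` inside `Fin h` is `S`: `benchCols h r ⟨bin S, _⟩ = S`. -/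
theorem benchCols_bin {h r : ℕ} (S : Finset (Fin h)) (hS : bin (S.map Fin.valEmbedding) < r) :
    benchCols h r ⟨bin (S.map Fin.valEmbedding), hS⟩ = S := by
  apply Finset.map_injective Fin.valEmbedding
  rw [map_benchCols _ (bin_map_lt_two_pow S), bits_bin]

/-- The benchmark columns are injective when `r ≤ 2^h`. -/
theorem benchCols_injective {h r : ℕ} (hr : r ≤ 2 ^ h) : Function.Injective (benchCols h r) := by
  intro j j' e
  have hj : (j : ℕ) < 2 ^ h := lt_of_lt_of_le j.2 hr
  have hj' : (j' : ℕ) < 2 ^ h := lt_of_lt_of_le j'.2 hr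
  apply Fin.ext
  apply bits_injective
  rw [← map_benchCols j hj, ← map_benchCols j' hj', e]

/-- Codes are monotone under inclusion of bit-sets. -/
theorem bin_le_bin_of_subset {s t : Finset ℕ} (hst : s ⊆ t) : bin s ≤ bin t :=
  Finset.sum_le_sum_of_subset_of_nonneg hst fun _ _ _ => Nat.zero_le _

/-- The benchmark columns are down-closed: every subset of a column is a column. -/
theorem benchCols_downClosed {h r : ℕ} (hr : r ≤ 2 ^ h) (j : Fin r) (S : Finset (Fin h))
    (hS : S ⊆ benchCols h r j) : ∃ j' : Fin r, benchCols h r j' = S := by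
  have hj : (j : ℕ) < 2 ^ h := lt_of_lt_of_le j.2 hr
  have hle : bin (S.map Fin.valEmbedding) ≤ (j : ℕ) := by
    have := bin_le_bin_of_subset (s := S.map Fin.valEmbedding)
      (t := (benchCols h r j).map Fin.valEmbedding) (Finset.map_subset_map.mpr hS)
    rwa [map_benchCols j hj, bin_bits] at this
  exact ⟨⟨bin (S.map Fin.valEmbedding), lt_of_le_of_lt hle j.2⟩, benchCols_bin S _⟩

/-! ## 2. Rows of `Θ̂` of size `≤ 2` are the stage-1 peel rows -/

section ThetaHat

variable {h : ℕ}

/-- The symbolic node table at a point of `Fin h` is the indeterminate. -/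
theorem nodeY_fin (b : Fin h) : nodeY h (b : ℕ) = X b := by
  rw [nodeY, dif_pos b.2]

/-- A product of Moore weights `∏_{c ∈ S} (X b)^(2^c) = (X b)^(bin S)`. -/
theorem prod_nodeY_pow (b : Fin h) (S : Finset (Fin h)) :
    ∏ c ∈ S, ((X b : MvPolynomial (Fin h) ℂ) ^ 2 ^ (c : ℕ)) =
      nodeY h (b : ℕ) ^ bin (S.map Fin.valEmbedding) := by
  rw [Finset.prod_pow_eq_pow_sum, nodeY_fin, bin, Finset.sum_map]
  rfl

/-- Row `∅` of `Θ̂` is the monomial row `e_0`. -/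
theorem thetaHat_empty_eq_rowVec {r : ℕ} (hr : r ≤ 2 ^ h) (j : Fin r) :
    coeff (∑ a ∈ (∅ : Finset (Fin h)), Finsupp.single (Fin.castAdd h a) 1 +
        ∑ c ∈ benchCols h r j, Finsupp.single (Fin.natAdd h c) 1)
      (∏ a ∈ (∅ : Finset (Fin h)), ∑ S ∈ (Finset.univ : Finset (Fin h)).powerset,
        monomial (∑ a' ∈ (∅ : Finset (Fin h)), Finsupp.single (Fin.castAdd h a') 1 +
          ∑ c ∈ S, Finsupp.single (Fin.natAdd h c) 1)
          ((-1 : MvPolynomial (Fin h) ℂ) ^ S.card * (S.card.factorial : MvPolynomial (Fin h) ℂ) *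
            ∏ c ∈ S, (X a : MvPolynomial (Fin h) ℂ) ^ 2 ^ (c : ℕ))) =
      (-1 : MvPolynomial (Fin h) ℂ) ^ (benchCols h r j).card *
        rowVec r (nodeY h) (Sum.inl 0) j := by
  rw [thetaHat_empty_row]
  have hj : (j : ℕ) < 2 ^ h := lt_of_lt_of_le j.2 hr
  have e0 : benchCols h r j = ∅ ↔ (j : ℕ) = 0 := by
    constructor
    · intro e
      have := map_benchCols j hj
      rw [e, Finset.map_empty] at this
      exact bits_injective (by rw [← this, bits_zero])
    · intro e
      apply Finset.map_injective Fin.valEmbedding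
      rw [map_benchCols j hj, e, bits_zero, Finset.map_empty]
  simp only [rowVec]
  by_cases h0 : (j : ℕ) = 0
  · rw [if_pos (e0.mpr h0), if_pos h0, e0.mpr h0, Finset.card_empty, pow_zero, one_mul]
  · rw [if_neg (fun e => h0 (e0.mp e)), if_neg h0, mul_zero]

/-- Row `{b}` of `Θ̂` is `(-1)^{|T|}` times the attached row `(T_0, {b})`. -/
theorem thetaHat_singleton_eq_rowVec {r : ℕ} (hr : r ≤ 2 ^ h) (b : Fin h) (j : Fin r) :
    coeff (∑ a ∈ (∅ : Finset (Fin h)), Finsupp.single (Fin.castAdd h a) 1 +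
        ∑ c ∈ benchCols h r j, Finsupp.single (Fin.natAdd h c) 1)
      (∏ a ∈ ({b} : Finset (Fin h)), ∑ S ∈ (Finset.univ : Finset (Fin h)).powerset,
        monomial (∑ a' ∈ (∅ : Finset (Fin h)), Finsupp.single (Fin.castAdd h a') 1 +
          ∑ c ∈ S, Finsupp.single (Fin.natAdd h c) 1)
          ((-1 : MvPolynomial (Fin h) ℂ) ^ S.card * (S.card.factorial : MvPolynomial (Fin h) ℂ) *
            ∏ c ∈ S, (X a : MvPolynomial (Fin h) ℂ) ^ 2 ^ (c : ℕ))) =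
      (-1 : MvPolynomial (Fin h) ℂ) ^ (benchCols h r j).card *
        rowVec r (nodeY h) (Sum.inr (Sum.inl (0, (b : ℕ)))) j := by
  rw [thetaHat_singleton_row]
  have hj : (j : ℕ) < 2 ^ h := lt_of_lt_of_le j.2 hr
  simp only [rowVec, bits_zero, Finset.empty_subset, if_true, Finset.card_empty, Nat.sub_zero,
    Finset.sdiff_empty]
  rw [prod_nodeY_pow, map_benchCols j hj, card_benchCols j hj, mul_assoc]

/-- Row `{b, b'}` of `Θ̂` (`b ≠ b'`) is `(-1)^{|T|}` times the pair row `(∅, {b, b'})`. -/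
theorem thetaHat_pair_eq_rowVec {r : ℕ} (hr : r ≤ 2 ^ h) (b b' : Fin h) (hbb : b ≠ b') (j : Fin r) :
    coeff (∑ a ∈ (∅ : Finset (Fin h)), Finsupp.single (Fin.castAdd h a) 1 +
        ∑ c ∈ benchCols h r j, Finsupp.single (Fin.natAdd h c) 1)
      (∏ a ∈ ({b, b'} : Finset (Fin h)), ∑ S ∈ (Finset.univ : Finset (Fin h)).powerset,
        monomial (∑ a' ∈ (∅ : Finset (Fin h)), Finsupp.single (Fin.castAdd h a') 1 +
          ∑ c ∈ S, Finsupp.single (Fin.natAdd h c) 1)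
          ((-1 : MvPolynomial (Fin h) ℂ) ^ S.card * (S.card.factorial : MvPolynomial (Fin h) ℂ) *
            ∏ c ∈ S, (X a : MvPolynomial (Fin h) ℂ) ^ 2 ^ (c : ℕ))) =
      (-1 : MvPolynomial (Fin h) ℂ) ^ (benchCols h r j).card *
        rowVec r (nodeY h) (Sum.inr (Sum.inr ((b : ℕ), (b' : ℕ)))) j := by
  classical
  have hj : (j : ℕ) < 2 ^ h := lt_of_lt_of_le j.2 hr
  rw [Finset.pair_comm, show ({b', b} : Finset (Fin h)) = insert b' {b} from rfl,
    thetaHat_insert _ b' {b} _ (by rw [Finset.mem_singleton]; exact fun e => hbb e.symm)]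
  simp_rw [thetaHat_singleton_row]
  simp only [rowVec]
  -- reindex the sum over `d ⊆ benchCols j` (in `Fin h`) as a sum over `d' ⊆ bits j` (in `ℕ`)
  set T := benchCols h r j with hT
  have hbitsT : bits (j : ℕ) = T.map Fin.valEmbedding := (map_benchCols j hj).symm
  rw [hbitsT]
  have himage : (T.map Fin.valEmbedding).powerset =
      T.powerset.image fun d => d.map Fin.valEmbedding := by
    rw [Finset.map_eq_image, Finset.powerset_image]
    congr 1
    funext d
    rw [Finset.map_eq_image]
  rw [himage, Finset.sum_image (fun d _ d' _ e => Finset.map_injective _ e), Finset.mul_sum]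
  refine Finset.sum_congr rfl fun d hd => ?_
  have hdT : d ⊆ T := Finset.mem_powerset.mp hd
  rw [← Finset.map_sdiff, Finset.card_map, Finset.card_map, prod_nodeY_pow, prod_nodeY_pow,
    ← Finset.card_sdiff_add_card_eq_card hdT, pow_add]
  ring

end ThetaHat

end Summit.ValiantsHypothesis.ValiantsHypothesis.Theorems.BarrierLever.MoorePeel
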